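import Summits.Ventures.HodgeRepro.PlaneFourier

/-!
# The four-point relation on the plane forces a period (the core of family (ii))

Blind re-derivation cell `pub-hodge-repro`, seat `p1` (gen 12).  A `{0,1}`-valued function `f` on the plane
`V = ℤ/p × ℤ/p` (`p` an odd prime) satisfying the **four-point relation**
`f(y − u₀) + f(y − u₁) = f(y − v₀) + f(y − v₁)` for every `y` is periodic under `v₀ − u₀` or under `v₁ − u₀`
(`periodic_of_fourRel`).  This is the combinatorial heart of `C₂ × C_p × C_p` (P1.md §17g, step (1)–(2)):
the relation is the `SumTwo` condition of a quadruple of Galois twists read on the layer `{0} × V`, and a period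
`v₀ − u₀` is a complex-conjugate pair of corners.

Proof.  (1) *Fourier support.*  Transforming the relation (`ft_shift`) gives, for every `k`,
`𝓕f(k) · (ψ(−⟨k,u₀⟩) + ψ(−⟨k,u₁⟩) − ψ(−⟨k,v₀⟩) − ψ(−⟨k,v₁⟩)) = 0`; by the Vieta lemma `pair_of_sum_eq` a `k` in
the support has `⟨k, v₀ − u₀⟩ = 0` or `⟨k, v₁ − u₀⟩ = 0` (`support_dot`).  (2) *Splitting.*  Fourier inversion
splits `p² f = A + B` along the annihilator of `h₁ = v₀ − u₀`: `A` is `h₁`-periodic, `B` is `h₂ = v₁ − u₀`-periodic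
(`sum_filter_dot_periodic`), so `f` satisfies the **mixed-difference identity**
`f(y + h₁ + h₂) − f(y + h₂) = f(y + h₁) − f(y)`.  (3) *Dichotomy* (`periodic_or_of_mixed`): a `{0,1}`-valued `f`
with this identity is `h₁`-periodic or `h₂`-periodic.  If `h₁ ∈ ℤ/p · h₂` (or symmetrically) the difference
`D(y) = f(y + h₁) − f(y)` is `h₁`-periodic, and the telescoping sum over a `p`-cycle gives `p · D(y) = 0`
(`diff_eq_zero_of_periodic`).  Otherwise `(j, k) ↦ j h₁ + k h₂` is injective, hence bijective, on the finite plane;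
if `f(y₀ + h₂) ≠ f(y₀)` then `D(y₀ + j h₁) = 0` for every `j` (a `{0,1}`-valued `D` at a point where the
`h₂`-difference is `±1` must vanish, `eq_of_ne_of_mixed`), and the `h₂`-periodicity of `D` spreads this to every
`y₀ + j h₁ + k h₂`, i.e. to the whole plane.
-/

set_option autoImplicit false

open Finset AddChar ZMod
open scoped Pointwise

namespace HodgeRepro.PlaneQuad

open HodgeRepro.CyclicQuad

variable {p : ℕ} [NeZero p]

/-! ### Periodicity bookkeeping on the plane -/

omit [NeZero p] in
/-- An `h`-periodic function is `n • h`-periodic. -/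
theorem periodic_nsmul_plane {f : ZMod p × ZMod p → ℂ} {h : ZMod p × ZMod p}
    (hf : ∀ y, f (y + h) = f y) (n : ℕ) (y : ZMod p × ZMod p) : f (y + n • h) = f y := by
  induction n with
  | zero => simp
  | succ n ih => rw [succ_nsmul, ← add_assoc, hf, ih]

/-- An `h`-periodic function is `m • h`-periodic for every scalar `m ∈ ℤ/p`. -/
theorem periodic_smul_plane {f : ZMod p × ZMod p → ℂ} {h : ZMod p × ZMod p}
    (hf : ∀ y, f (y + h) = f y) (m : ZMod p) (y : ZMod p × ZMod p) : f (y + m • h) = f y := by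
  rw [← ZMod.natCast_zmod_val m, Nat.cast_smul_eq_nsmul]
  exact periodic_nsmul_plane hf _ y

omit [NeZero p] in
/-- `p • h = 0` on the plane. -/
theorem card_nsmul_eq_zero (h : ZMod p × ZMod p) : p • h = 0 := by
  rw [← Nat.cast_smul_eq_nsmul (ZMod p), ZMod.natCast_self, zero_smul]

/-- **Telescoping over a `p`-cycle**: if the difference `D(y) = f(y + h) − f(y)` is itself `h`-periodic, it vanishes. -/
theorem diff_eq_zero_of_periodic {f : ZMod p × ZMod p → ℂ} {h : ZMod p × ZMod p}
    (hD : ∀ y, f (y + h + h) - f (y + h) = f (y + h) - f y) (y : ZMod p × ZMod p) : f (y + h) = f y := by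
  have hper : ∀ n : ℕ, f (y + n • h + h) - f (y + n • h) = f (y + h) - f y := by
    intro n
    induction n with
    | zero => simp
    | succ n ih => rw [succ_nsmul, ← add_assoc, hD, ih]
  have hsum : ∑ i ∈ Finset.range p, (f (y + (i + 1) • h) - f (y + i • h)) =
      f (y + p • h) - f (y + 0 • h) := Finset.sum_range_sub (fun i => f (y + i • h)) p
  rw [card_nsmul_eq_zero, zero_nsmul, add_zero, sub_self] at hsum
  have hconst : ∀ i ∈ Finset.range p, f (y + (i + 1) • h) - f (y + i • h) = f (y + h) - f y := by
    intro i _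
    rw [succ_nsmul, ← add_assoc]
    exact hper i
  rw [Finset.sum_congr rfl hconst, Finset.sum_const, Finset.card_range, nsmul_eq_mul] at hsum
  have hp0 : (p : ℂ) ≠ 0 := Nat.cast_ne_zero.mpr (NeZero.ne p)
  exact sub_eq_zero.mp ((mul_eq_zero.mp hsum).resolve_left hp0)

omit [NeZero p] in
/-- At a point where the `h₂`-difference of a `{0,1}`-valued `f` is non-zero, the `h₁`-difference vanishes
(from the mixed-difference identity). -/
theorem eq_of_ne_of_mixed {f : ZMod p × ZMod p → ℂ} (hf : ∀ y, f y = 0 ∨ f y = 1)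
    {h₁ h₂ : ZMod p × ZMod p} (hmix : ∀ y, f (y + h₁ + h₂) - f (y + h₂) = f (y + h₁) - f y)
    (y : ZMod p × ZMod p) (hne : f (y + h₂) ≠ f y) : f (y + h₁) = f y := by
  have h := hmix y
  rcases hf y with h0 | h0 <;> rcases hf (y + h₁) with h1 | h1 <;> rcases hf (y + h₂) with h2 | h2 <;>
    rcases hf (y + h₁ + h₂) with h3 | h3 <;>
    (rw [h0, h1, h2, h3] at h; rw [h0, h2] at hne; rw [h0, h1]) <;>
    first | exact absurd rfl hne | (exfalso; norm_num at h)

/-- **The mixed-difference dichotomy on the plane.**  A `{0,1}`-valued `f` with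
`f(y + h₁ + h₂) − f(y + h₂) = f(y + h₁) − f(y)` for every `y` is `h₁`-periodic or `h₂`-periodic. -/
theorem periodic_or_of_mixed (hp : p.Prime) {f : ZMod p × ZMod p → ℂ} (hf : ∀ y, f y = 0 ∨ f y = 1)
    (h₁ h₂ : ZMod p × ZMod p) (hmix : ∀ y, f (y + h₁ + h₂) - f (y + h₂) = f (y + h₁) - f y) :
    (∀ y, f (y + h₁) = f y) ∨ (∀ y, f (y + h₂) = f y) := by
  haveI := Fact.mk hp
  -- the two differences are periodic under the other translation
  have hD : ∀ y, f (y + h₂ + h₁) - f (y + h₂) = f (y + h₁) - f y := fun y => by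
    rw [add_right_comm]; exact hmix y
  have hE : ∀ y, f (y + h₁ + h₂) - f (y + h₁) = f (y + h₂) - f y := fun y => by
    have := hmix y; linear_combination this
  by_cases hdep₁ : ∃ m : ZMod p, h₁ = m • h₂
  · obtain ⟨m, rfl⟩ := hdep₁
    left
    intro y
    apply diff_eq_zero_of_periodic (f := f) (h := m • h₂) _ y
    intro z
    exact periodic_smul_plane (f := fun y => f (y + m • h₂) - f y) (h := h₂) (fun y => hD y) m z
  by_cases hdep₂ : ∃ m : ZMod p, h₂ = m • h₁
  · obtain ⟨m, rfl⟩ := hdep₂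
    right
    intro y
    apply diff_eq_zero_of_periodic (f := f) (h := m • h₁) _ y
    intro z
    exact periodic_smul_plane (f := fun y => f (y + m • h₁) - f y) (h := h₁) (fun y => hE y) m z
  -- independent: `(j, k) ↦ j h₁ + k h₂` is injective, hence surjective
  have hinj : Function.Injective (fun jk : ZMod p × ZMod p => jk.1 • h₁ + jk.2 • h₂) := by
    intro a b hab
    simp only at hab
    have e : (a.1 - b.1) • h₁ = (b.2 - a.2) • h₂ := by
      rw [sub_smul, sub_smul, sub_eq_sub_iff_add_eq_add, hab, add_comm]
    by_cases ha : a.1 = b.1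
    · rw [ha, sub_self, zero_smul] at e
      by_cases hb : a.2 = b.2
      · exact Prod.ext ha hb
      · exfalso
        apply hdep₂
        refine ⟨0, ?_⟩
        have hne : b.2 - a.2 ≠ 0 := sub_ne_zero.mpr (Ne.symm hb)
        calc h₂ = (b.2 - a.2)⁻¹ • ((b.2 - a.2) • h₂) := by
              rw [smul_smul, inv_mul_cancel₀ hne, one_smul]
          _ = (0 : ZMod p) • h₁ := by rw [← e, smul_zero, zero_smul]
    · exfalso
      apply hdep₁
      refine ⟨(a.1 - b.1)⁻¹ * (b.2 - a.2), ?_⟩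
      have hne : a.1 - b.1 ≠ 0 := sub_ne_zero.mpr ha
      rw [← smul_smul, ← e, smul_smul, inv_mul_cancel₀ hne, one_smul]
  have hsurj := Finite.injective_iff_surjective.mp hinj
  by_cases hper₂ : ∀ y, f (y + h₂) = f y
  · exact Or.inr hper₂
  left
  obtain ⟨y₀, hy₀⟩ := not_forall.mp hper₂
  intro y
  obtain ⟨⟨j, k⟩, hjk⟩ := hsurj (y - y₀)
  simp only at hjk
  have hy : y = y₀ + j • h₁ + k • h₂ := by rw [add_assoc, hjk, add_sub_cancel]
  -- the `h₂`-difference at `y₀ + j • h₁` is the one at `y₀`, non-zero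
  have hE' : f (y₀ + j • h₁ + h₂) ≠ f (y₀ + j • h₁) := by
    intro heq
    apply hy₀
    have := periodic_smul_plane (f := fun y => f (y + h₂) - f y) (h := h₁) (fun y => hE y) j y₀
    rw [heq, sub_self] at this
    exact (sub_eq_zero.mp this.symm)
  -- hence the `h₁`-difference vanishes there, and `h₂`-periodicity of the `h₁`-difference spreads it to `y`
  have hD0 : f (y₀ + j • h₁ + h₁) = f (y₀ + j • h₁) := eq_of_ne_of_mixed hf hmix _ hE'
  have hDper := periodic_smul_plane (f := fun y => f (y + h₁) - f y) (h := h₂) (fun y => hD y) k (y₀ + j • h₁)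
  rw [hD0, sub_self] at hDper
  rw [hy]
  exact sub_eq_zero.mp hDper

/-! ### The four-point relation -/

/-- A partial Fourier sum over a set of frequencies annihilating `h` (or where `𝓕f` vanishes) is `h`-periodic. -/
theorem sum_filter_dot_periodic (f : ZMod p × ZMod p → ℂ) (h y : ZMod p × ZMod p)
    (S : Finset (ZMod p × ZMod p)) (hS : ∀ k ∈ S, ft f k = 0 ∨ dot k h = 0) :
    ∑ k ∈ S, ft f k * stdAddChar (dot k (y + h)) = ∑ k ∈ S, ft f k * stdAddChar (dot k y) := by
  refine Finset.sum_congr rfl (fun k hk => ?_)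
  rcases hS k hk with h0 | h0
  · rw [h0, zero_mul, zero_mul]
  · rw [dot_add_right, h0, add_zero]

/-- **Fourier support of the four-point relation**: every frequency `k` in the support of `𝓕f` annihilates
`v₀ − u₀` or `v₁ − u₀`. -/
theorem support_dot (hp : p.Prime) (hp2 : p ≠ 2) (f : ZMod p × ZMod p → ℂ) (u₀ u₁ v₀ v₁ : ZMod p × ZMod p)
    (hrel : ∀ y, f (y - u₀) + f (y - u₁) = f (y - v₀) + f (y - v₁)) (k : ZMod p × ZMod p) :
    ft f k = 0 ∨ dot k (v₀ - u₀) = 0 ∨ dot k (v₁ - u₀) = 0 := by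
  have h1 : ft (fun y => f (y - u₀)) k + ft (fun y => f (y - u₁)) k =
      ft (fun y => f (y - v₀)) k + ft (fun y => f (y - v₁)) k := by
    simp only [ft, ← Finset.sum_add_distrib, ← add_mul]
    exact Finset.sum_congr rfl (fun y _ => by rw [hrel y])
  rw [ft_shift, ft_shift, ft_shift, ft_shift, ← add_mul, ← add_mul] at h1
  by_cases h0 : ft f k = 0
  · exact Or.inl h0
  have h2 := mul_right_cancel₀ h0 h1
  rcases pair_of_sum_eq hp hp2 h2 with ⟨e1, _⟩ | ⟨e1, _⟩
  · right; left
    rw [dot_sub_right, sub_eq_zero]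
    exact (neg_inj.mp e1).symm
  · right; right
    rw [dot_sub_right, sub_eq_zero]
    exact (neg_inj.mp e1).symm

/-- **The four-point relation forces a period.**  A `{0,1}`-valued `f` on the plane with
`f(y − u₀) + f(y − u₁) = f(y − v₀) + f(y − v₁)` for every `y` is periodic under `v₀ − u₀` or under `v₁ − u₀`. -/
theorem periodic_of_fourRel (hp : p.Prime) (hp2 : p ≠ 2) {f : ZMod p × ZMod p → ℂ}
    (hf : ∀ y, f y = 0 ∨ f y = 1) (u₀ u₁ v₀ v₁ : ZMod p × ZMod p)
    (hrel : ∀ y, f (y - u₀) + f (y - u₁) = f (y - v₀) + f (y - v₁)) :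
    (∀ y, f (y + (v₀ - u₀)) = f y) ∨ (∀ y, f (y + (v₁ - u₀)) = f y) := by
  have key := support_dot hp hp2 f u₀ u₁ v₀ v₁ hrel
  set h₁ := v₀ - u₀ with hh₁
  set h₂ := v₁ - u₀ with hh₂
  -- the two partial Fourier sums
  obtain ⟨A, hA⟩ : ∃ A : ZMod p × ZMod p → ℂ, ∀ y,
      A y = ∑ k ∈ univ.filter (fun k => dot k h₁ = 0), ft f k * stdAddChar (dot k y) :=
    ⟨fun y => _, fun y => rfl⟩
  obtain ⟨B, hB⟩ : ∃ B : ZMod p × ZMod p → ℂ, ∀ y,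
      B y = ∑ k ∈ univ.filter (fun k => ¬ dot k h₁ = 0), ft f k * stdAddChar (dot k y) :=
    ⟨fun y => _, fun y => rfl⟩
  have hAB : ∀ y, (p : ℂ) ^ 2 * f y = A y + B y := fun y => by
    rw [← ft_inversion, hA, hB, Finset.sum_filter_add_sum_filter_not]
  have hAper : ∀ y, A (y + h₁) = A y := fun y => by
    rw [hA, hA]
    exact sum_filter_dot_periodic f h₁ y _ (fun k hk => Or.inr (Finset.mem_filter.mp hk).2)
  have hBper : ∀ y, B (y + h₂) = B y := fun y => by
    rw [hB, hB]
    refine sum_filter_dot_periodic f h₂ y _ (fun k hk => ?_)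
    rcases key k with h0 | h0 | h0
    · exact Or.inl h0
    · exact absurd h0 (Finset.mem_filter.mp hk).2
    · exact Or.inr h0
  have hmix : ∀ y, f (y + h₁ + h₂) - f (y + h₂) = f (y + h₁) - f y := by
    intro y
    have hp0 : (p : ℂ) ^ 2 ≠ 0 := pow_ne_zero 2 (Nat.cast_ne_zero.mpr (NeZero.ne p))
    apply mul_left_cancel₀ hp0
    rw [mul_sub, mul_sub, hAB, hAB, hAB, hAB, hBper (y + h₁), add_right_comm y h₁ h₂, hAper (y + h₂),
      hAper y, hBper y]
    ring
  exact periodic_or_of_mixed hp hf h₁ h₂ hmix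

end HodgeRepro.PlaneQuad
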